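import Summits.QuantumFields.QCD.Theses.NestedDissectionSea
import Literature.Barriers.QuantumFields.WilsonDeterminantSign
import Literature.MathematicalPhysics.QuantumFieldTheory.LatticeGaugeProofs

/-!
# `SeaFactorisationBridge` (crux stmt-QuantumFields-13880), line `proper-time-quarantine`: shared vocabulary I —
# the quarantine split and the reference sea

The DEFINITIONS over which the registered stubs of the line `proper-time-quarantine` (crux
`Summit.QuantumFields.QCD.Theses.NestedDissectionSea.SeaFactorisationBridge`, route `NestedDissectionSea`) are typed,
byte-identical to the registered skeleton `Cruxes/SeaFactorisationBridge/Lines/proper_time_quarantine.lean` (r13,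
continuation lead c2, 2026-08-16) — moved into modules (this file and `…SeaFactorisationBridgeLineDefsEdge.lean`) so
that the landed stub files, the kernel-checked composition (`…SeaFactorisationBridgeLineComposition.lean`) and the
skeleton share ONE copy, and a planner promoting a stub to an item can import the exact vocabulary.  Nothing is
asserted: every declaration is a `def` (objects and `Prop`-valued predicates the LINE posits — not published facts,
hence no `[cite]`/relocation) plus the registered sanity sub-goal `refWeight_pos` (the reference weight is a positive
exponential).

Contents (section numbers as in the skeleton): §0 proper-time profiles (`expIntE₁`, `uvProfile`, `FrullaniToolkit`);
§1 the quarantine split at matrix level (`QIdx`, `specH`, `uvFunctional`, `irFunctional`, `edgeFactor`,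
`UVFunctionalContinuous`, `QuarantineIdentity`, `ProperTimeSplit`); §2 support-form coercivity and the
Feshbach–Combes–Thomas localisation statement (`IsCoerciveOn`, `IsAnchoredLipschitz`, `FeshbachLocalisation`);
§3 `PureGaugeInput` (= `RobustYangMills` at `W ≡ 0`); §4 the reference sea `μ_ref ∝ Wilson(β_k)·e^{Σ_f F}`
(`tZero`, `refWeight`, `refExpect`, `refConnectedCorr`, `refSchwinger`, `RefSeaControlled`, `RefSeaTreeMixing`,
`RefSeaIRUniversality`).  The docstrings keep the reshape history r1–r13 (three leads, five waves): it is the typing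
evidence a planner needs.
-/

noncomputable section

namespace Summit.QuantumFields.QCD.Cruxes.SeaFactorisationBridge.ProperTimeQuarantine

open scoped SchwartzMap BigOperators Topology Classical MeasureTheory Matrix ComplexConjugate ComplexOrder
open Filter MeasureTheory
open Literature.MathematicalPhysics.AQFT
open Literature.MathematicalPhysics.QuantumFieldTheory Literature.MathematicalPhysics.QuantumLattice
open Literature.Probability.LatticeModels
open Summit.QuantumFields.QCD.Theses.NestedDissectionSea

/-- Local notation: the colour group `SU(3)`. -/
local notation "𝔾" => Matrix.specialUnitaryGroup (Fin 3) ℂ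

/-! ## §0 Proper-time profiles (scalar level) -/

/-- The exponential integral `E₁(x) = ∫_{(x,∞)} e^{-s}/s ds` (Bochner; junk `0` at `x ≤ 0`). -/
def expIntE₁ (x : ℝ) : ℝ := ∫ s in Set.Ioi x, Real.exp (-s) / s

/-- The UV profile `uvProfile t₀ λ = -∫_{(0,t₀]} (e^{-tλ} - e^{-t})/t dt` — the proper-time
integral of the Frullani representation of `log λ` CUT at `t₀`; entire in `λ`. -/
def uvProfile (t₀ lam : ℝ) : ℝ :=
  -∫ t in Set.Ioc 0 t₀, (Real.exp (-(t * lam)) - Real.exp (-t)) / t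

/-- **Frullani toolkit** (scalar content of the split): the identity
`log λ = uvProfile t₀ λ − E₁(t₀λ) + E₁(t₀)` (`λ, t₀ > 0`), the tail bounds `0 ≤ E₁(x) ≤ e^{-x}/x`, the
Lipschitz bound `|uvProfile t₀ λ| ≤ t₀|λ − 1|` and the logarithmic bound
`|uvProfile t₀ λ| ≤ 4 + log(1+λ) + log t₀` (`t₀ ≥ 1`, `λ ≥ 0`). -/
def FrullaniToolkit : Prop :=
  (∀ t₀ lam : ℝ, 0 < t₀ → 0 < lam →
      Real.log lam = uvProfile t₀ lam - expIntE₁ (t₀ * lam) + expIntE₁ t₀) ∧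
  (∀ x : ℝ, 0 < x → 0 ≤ expIntE₁ x ∧ expIntE₁ x ≤ Real.exp (-x) / x) ∧
  (∀ t₀ lam : ℝ, 0 < t₀ → 0 ≤ lam → |uvProfile t₀ lam| ≤ t₀ * |lam - 1|) ∧
  (∀ t₀ lam : ℝ, 1 ≤ t₀ → 0 ≤ lam → |uvProfile t₀ lam| ≤ 4 + Real.log (1 + lam) + Real.log t₀)

/-! ## §1 Matrix level: the quarantine split of `log |det D_W|` -/

/-- Quark index of one flavour on the torus of side `N`: site × colour × spin. -/
abbrev QIdx (N : ℕ) : Type := TorusSite 4 N × Fin 3 × Fin 4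

variable {N : ℕ} [NeZero N]

/-- The real spectrum `λ_i(U, μ)` of the Hermitian Wilson–Dirac operator `H = Γ₅ D_W(U, μ, 1)`
(tree `hermitianWilsonDirac`, `isHermitian_hermitianWilsonDirac`). -/
def specH (U : GaugeConfig 4 N 𝔾) (μ : ℝ) : QIdx N → ℝ :=
  (Literature.Barriers.QuantumFields.WilsonDeterminant.isHermitian_hermitianWilsonDirac
    (fundamentalRep (Fin 3)) fundamentalRep_mem_unitaryGroup U μ 1).eigenvalues

/-- The **UV functional** `F_{t₀}(U, μ) = ½ Σ_i uvProfile t₀ (λ_i²)` (`= ½ Tr uvProfile_{t₀}(H²)`):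
entire in the links, finite for EVERY gauge field. -/
def uvFunctional (t₀ : ℝ) (U : GaugeConfig 4 N 𝔾) (μ : ℝ) : ℝ :=
  (1 / 2) * ∑ i, uvProfile t₀ (specH U μ i ^ 2)

/-- The **IR (edge) functional** `W_{t₀}(U, μ) = ½ Σ_i E₁(t₀ λ_i²) ≥ 0` (junk on the zero locus). -/
def irFunctional (t₀ : ℝ) (U : GaugeConfig 4 N 𝔾) (μ : ℝ) : ℝ :=
  (1 / 2) * ∑ i, expIntE₁ (t₀ * specH U μ i ^ 2)

/-- The **edge factor** `g_{t₀}(U, μ) = Re det D_W(U, μ, 1) · e^{−F_{t₀}(U,μ) − (n/2) E₁(t₀)}`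
(`n` = number of quark indices): by the split it equals `sign(det) · e^{−W_{t₀}} ∈ [−1, 1]` off the
zero locus and `0` on it. -/
def edgeFactor (t₀ : ℝ) (U : GaugeConfig 4 N 𝔾) (μ : ℝ) : ℝ :=
  (fermionDet (wilsonDirac (fundamentalRep (Fin 3)) U μ 1)).re *
    Real.exp (-(uvFunctional t₀ U μ) - (Fintype.card (QIdx N) : ℝ) / 2 * expIntE₁ t₀)

/-- **Continuity of the UV functional in the gauge field** (`U ↦ F_{t₀}(U, μ)` is continuous on the
compact configuration space, for every torus, proper time and mass): the technical debt "T1" of the line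
(wave-3 worker on stub 4) — every statement about the reference expectation `refExpect` needs the weight
`exp(Σ_f F)` measurable and its normalisation positive before it says anything.  Registered as stub 8
(`stub_uvFunctionalContinuous`, tree vocabulary; provable now: Weyl's perturbation bound for the sorted
eigenvalues + the `t₀`-Lipschitz UV profile) and consumed by stub 6. -/
def UVFunctionalContinuous : Prop :=
  ∀ (N : ℕ) [NeZero N] (t₀ μ : ℝ), Continuous fun U : GaugeConfig 4 N 𝔾 => uvFunctional t₀ U μ

/-- **Quarantine identity** (matrix content of the split), for every torus, field, mass and
`t₀ > 0`: (a) off the zero locus `|det D_W| = e^{F + (n/2)E₁(t₀)} · e^{−W}`; (b) the edge factor is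
bounded by one in modulus and `W ≥ 0`, for EVERY field; (c) the UV functional has LOG-bounded density
uniformly in the field: `|F| ≤ (n/2)(4 + 2 log(|μ+4|+5) + log t₀)` for `t₀ ≥ 1`
(`λ_i² ≤ ‖H‖² ≤ (|μ+4|+4)²`, tree `l2_opNorm_sum_wilsonHop_le`). -/
def QuarantineIdentity : Prop :=
  ∀ (N : ℕ) [NeZero N] (U : GaugeConfig 4 N 𝔾) (μ t₀ : ℝ), 0 < t₀ →
    (fermionDet (wilsonDirac (fundamentalRep (Fin 3)) U μ 1) ≠ 0 →
      ‖fermionDet (wilsonDirac (fundamentalRep (Fin 3)) U μ 1)‖ =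
        Real.exp (uvFunctional t₀ U μ + (Fintype.card (QIdx N) : ℝ) / 2 * expIntE₁ t₀) *
          Real.exp (-(irFunctional t₀ U μ))) ∧
    |edgeFactor t₀ U μ| ≤ 1 ∧ 0 ≤ irFunctional t₀ U μ ∧
    (1 ≤ t₀ → |uvFunctional t₀ U μ| ≤
      (Fintype.card (QIdx N) : ℝ) / 2 * (4 + 2 * Real.log (|μ + 4| + 5) + Real.log t₀))

/-- The split, scalar and matrix level together. -/
def ProperTimeSplit : Prop := FrullaniToolkit ∧ QuarantineIdentity

/-! ## §2 Feshbach–Combes–Thomas localisation of sub-threshold modes (deterministic) -/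

/-- **Coercivity of a Dirichlet restriction** (support form; lead reshape 2026-08-16): the
principal block of `D_W(U, μ, 1)` on the quark indices whose site satisfies `Ω` has smallest
singular value `≥ κ` — for every `v` SUPPORTED on the `Ω`-sites,
`κ² ‖v‖² ≤ Σ_{p : Ω p.site} ‖(D_W v)_p‖²` (`= ‖P_Ω D_W P_Ω v‖²`; equivalent to the block form). -/
def IsCoerciveOn (U : GaugeConfig 4 N 𝔾) (μ : ℝ) (Ω : TorusSite 4 N → Prop) (κ : ℝ) : Prop :=
  ∀ v : QIdx N → ℂ, (∀ p, ¬ Ω p.1 → v p = 0) →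
    κ ^ 2 * ∑ p, ‖v p‖ ^ 2 ≤
      ∑ p ∈ Finset.univ.filter (fun p : QIdx N => Ω p.1),
        ‖(wilsonDirac (fundamentalRep (Fin 3)) U μ 1).mulVec v p‖ ^ 2

/-- **A lattice-Lipschitz weight anchored on the violating set**: `φ = 0` off `Ω` and `φ` changes by
at most `1` across every lattice bond `x — x + μ̂` (e.g. the `ℓ¹` torus distance to `{¬Ω}`). -/
def IsAnchoredLipschitz (Ω : TorusSite 4 N → Prop) (φ : TorusSite 4 N → ℕ) : Prop :=
  (∀ y, ¬ Ω y → φ y = 0) ∧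
    ∀ (x : TorusSite 4 N) (i : Fin 4), φ (Site.shift x i) ≤ φ x + 1 ∧ φ x ≤ φ (Site.shift x i) + 1

/-- **Feshbach–Combes–Thomas localisation** (lead reshape 2026-08-16: general anchored Lipschitz
weight, constants loosened to `(32/κ)²` and `ν = log(1 + κ/32)` so that the crude per-hop bound
`‖E W_μ E⁻¹ − W_μ‖ ≤ 2(e^ν − 1)` suffices).  If the Dirichlet restriction of `D_W(U, μ, 1)` to the sites
satisfying `Ω` is `κ`-coercive, then every eigenvector `H w = λ w` of the Hermitian operator `H = Γ₅ D_W`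
with `|λ| ≤ κ/2` carries, where an anchored Lipschitz weight `φ` is `≥ r`, at most the fraction
`(32/κ)² e^{−2ν(r−1)}` of its mass.  Proof sketch (all finite-dimensional): with `E = diag(e^{νφ})`,
`P_Ω(H−λ)P_Ω w_Ω = −P_Ω H P_{Ωᶜ} w =: b` (supported where `φ ≤ 1`, `‖b‖ ≤ 4‖w‖`), and
`‖E P_Ω(H−λ)P_Ω E⁻¹ u‖ ≥ (κ − κ/2 − 8(e^ν−1))‖u‖ = (κ/4)‖u‖` for `u` supported on `Ω`
(coercivity, `Γ₅` unitary and site-diagonal, `|λ| ≤ κ/2`, Combes–Thomas for the four hops of norm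
`≤ 1`, `wilsonDirac_eq_sub_sum_wilsonHop` / `l2_opNorm_wilsonHop_le`), whence
`‖E w_Ω‖ ≤ (4/κ) e^ν · 4‖w‖`. -/
def FeshbachLocalisation : Prop :=
  ∀ (N : ℕ) [NeZero N] (U : GaugeConfig 4 N 𝔾) (μ : ℝ) (Ω : TorusSite 4 N → Prop) (κ : ℝ),
    0 < κ → IsCoerciveOn U μ Ω κ →
      ∀ φ : TorusSite 4 N → ℕ, IsAnchoredLipschitz Ω φ →
      ∀ (w : QIdx N → ℂ) (lam : ℝ), |lam| ≤ κ / 2 →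
        (Literature.Barriers.QuantumFields.WilsonDeterminant.hermitianWilsonDirac
            (fundamentalRep (Fin 3)) U μ 1).mulVec w = (lam : ℂ) • w →
          ∀ r : ℕ,
            ∑ p ∈ Finset.univ.filter (fun p : QIdx N => r ≤ φ p.1), ‖w p‖ ^ 2 ≤
              (32 / κ) ^ 2 * Real.exp (-(2 * Real.log (1 + κ / 32) * ((r : ℝ) - 1))) *
                ∑ p, ‖w p‖ ^ 2

/-! ## §3 What hypothesis 1 (`RobustYangMills`) gives at `W ≡ 0` (sorry-free reduction) -/

/-- **Pure-gauge input**: along EVERY scaling data `(a, L)` and every pure-gauge two-loop profile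
`β′` (`β′_k − afBeta 0 Λ′ a_k → 0`), Wilson's `SU(3)` lattice Yang–Mills has a subsequence with an OS
continuum limit of all gauge-invariant species, non-trivial and non-Gaussian curvature, a mass gap
`Δ > 0`, and lattice exponential clustering at rate `Δ` uniformly in the volume eventually in `k`
(full sequence).  This is `RobustYangMills` instantiated at `W ≡ 0` (`pureGaugeInput_of_robustYangMills`). -/
def PureGaugeInput : Prop :=
  let ρ : 𝔾 →* Matrix (Fin 3) (Fin 3) ℂ := fundamentalRep (Fin 3)
  let r₃ : LatticeRep 𝔾 := ⟨3, ρ, continuous_fundamentalRep _, fundamentalRep_injective _,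
    fundamentalRep_mem_unitaryGroup⟩
  ∀ (a : ℕ → ℝ) (L : ℕ → ℕ) (ha : ∀ k, 0 < a k) (ha₀ : Tendsto a atTop (𝓝 0))
    (haL : Tendsto (fun k => a k * L k) atTop atTop) (β' : ℕ → ℝ) (Λ' : ℝ), 0 < Λ' →
    Tendsto (fun k => β' k - afBeta 0 Λ' (a k)) atTop (𝓝 0) →
      ∃ φ : ℕ → ℕ, StrictMono φ ∧ ∃ (c m : YMSpecies 𝔾 → ℕ → ℝ) (T : OSData (YMSpecies 𝔾) 4) (Δ : ℝ),
        0 < Δ ∧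
        (∀ n : ℕ, n ≠ 0 → ∀ (σ : Fin n → YMSpecies 𝔾) (f : Fin n → 𝓢(EuclideanSpace ℝ (Fin 4), ℝ))
            (F : 𝓢((Fin n → EuclideanSpace ℝ (Fin 4)), ℂ)),
            IsTensorOf F (fun i => ofRealTest (f i)) → IsOffDiagonal F →
              Tendsto (fun j : ℕ => ((latticeSchwinger ρ
                (⟨a, ha, ha₀, β', L, haL, c, m⟩ : SpeciesScheme (YMSpecies 𝔾)) (fun s => s.F) (φ j) n σ f : ℝ) : ℂ))
                atTop (𝓝 (T.schwinger n σ F))) ∧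
        T.IsNontrivial r₃.curvature ∧ T.IsNonGaussian r₃.curvature ∧ T.HasMassGap Δ ∧
        (∀ A B : YMSpecies 𝔾, ∃ C : ℝ, ∀ᶠ k in atTop, ∀ S : ℕ, L k ≤ S → ∀ n : ℕ, n ≤ S →
          |latticeConnectedCorr ρ (β' k) (2 * S + 1) A.F B.F n| ≤ C * Real.exp (-(Δ * (a k * n))))

/-! ## §4 The reference sea `μ_ref` (output format of the UV half) -/

section Reference

variable {Nf : ℕ}

/-- The Wegner-matched proper time **at the gap scale** `t₀(k) = (ℓ_q Z_m(k) / a_k)²` (lattice units):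
UV/IR split at the physical length `ℓ_q` converted to BARE spectral units by the same factor `1/Z_m(k)`
that converts renormalised to bare masses in the scheme (`m_f(k) − m_crit(k) = a_k m_f/Z_m(k)`): the bare
low spectrum of the Wilson operator near the critical line is compressed by `Z_P ≍ c/Z_m(k) → 0`
(mode-number renormalisation), so a `k`-uniform threshold must be `t a_k/(ℓ Z_m(k))`, not `t a_k/ℓ`
(lead reshape r2, 2026-08-16, on the stub-4 worker's verdict `stub-misstated`: with kinematic thresholds
window-top cells become typically resonant eventually and (E1) fails). -/
def tZero (reg : QCDRegularisation Nf) (ℓq : ℝ) (k : ℕ) : ℝ := (ℓq * reg.Zm k / reg.a k) ^ 2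

/-- **The reference (quarantined) sea weight** `w_ref(U) = exp(Σ_f F_{t₀(k)}(U, m_f(k)))` at step `k`
on the torus of side `2S+1`, bare masses `m_f(k) = m_crit(k) + a_k m_f / Z_m(k)`: positive, bounded,
entire in the links; `∏_f |det D_W(m_f(k))| = w_ref · e^{−Σ_f W_f} · const` (quarantine identity). -/
def refWeight (reg : QCDRegularisation Nf) (m : Fin Nf → ℝ) (ℓq : ℝ) (k : ℕ) {S : ℕ}
    (U : GaugeConfig 4 (2 * S + 1) 𝔾) : ℝ :=
  Real.exp (∑ f, uvFunctional (tZero reg ℓq k) U (reg.mcrit k + reg.a k * m f / reg.Zm k))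

/-- Expectation under the **reference measure** `μ_ref ∝ w_ref · (Wilson measure at β_k)` on the torus
of side `2S+1` (ratio of Bochner integrals; the denominator is positive). -/
def refExpect (reg : QCDRegularisation Nf) (m : Fin Nf → ℝ) (ℓq : ℝ) (k S : ℕ)
    (X : GaugeConfig 4 (2 * S + 1) 𝔾 → ℝ) : ℝ :=
  (∫ U, X U * refWeight reg m ℓq k U
      ∂(wilsonMeasure (d := 4) (L := 2 * S + 1) (fundamentalRep (Fin 3)) (reg.β k))) /
    ∫ U, refWeight reg m ℓq k U
      ∂(wilsonMeasure (d := 4) (L := 2 * S + 1) (fundamentalRep (Fin 3)) (reg.β k))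

/-- Connected Euclidean-time correlation `⟨A · τ_{n e₀} B⟩_ref − ⟨A⟩_ref ⟨B⟩_ref` under the reference
measure (periodic lift; the `μ_ref`-twin of the tree's `latticeConnectedCorr`). -/
def refConnectedCorr (reg : QCDRegularisation Nf) (m : Fin Nf → ℝ) (ℓq : ℝ) (k S : ℕ)
    (A B : LGConfig 4 𝔾 → ℝ) (n : ℕ) : ℝ :=
  refExpect reg m ℓq k S (fun U => A (torusLift (2 * S + 1) U) *
      B (configShift (-Pi.single 0 (n : ℤ)) (torusLift (2 * S + 1) U))) -
    refExpect reg m ℓq k S (fun U => A (torusLift (2 * S + 1) U)) *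
      refExpect reg m ℓq k S (fun U => B (torusLift (2 * S + 1) U))

/-- Smeared renormalised `n`-point functions of gauge-invariant species under the reference measure on
the scheme's own torus `2L_k+1` (the `μ_ref`-twin of the tree's `latticeSchwinger`). -/
def refSchwinger (reg : QCDRegularisation Nf) (m : Fin Nf → ℝ) (ℓq : ℝ)
    (c sh : YMSpecies 𝔾 → ℕ → ℝ) (k n : ℕ) (σ : Fin n → YMSpecies 𝔾)
    (f : Fin n → 𝓢(EuclideanSpace ℝ (Fin 4), ℝ)) : ℝ :=
  refExpect reg m ℓq k (reg.L k) fun U =>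
    ∏ i, smearedLatticeField ((σ i).F) (Literature.Probability.LatticeModels.box 4 (reg.L k))
      (reg.a k) (c (σ i) k) (sh (σ i) k) (f i) (torusLift (2 * reg.L k + 1) U)

/-- **The reference sea is controlled — (R1) lattice gap** (output of the UV half at split length `ℓ_q`, mass
tuple `m`): the positive bosonic lattice gauge theory `μ_ref = Wilson(β_k) · e^{Σ_f F_f}` has a lattice mass gap
`Δ₀ > 0` — exponential clustering of all gauge-invariant bounded cylinder observables, uniformly in the volume,
eventually in `k`.  (r12, wave-4 audit A2: the continuum clause (R2) of r2–r11 MOVED into M3 `RefSeaIRUniversality`,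
so that ONE witness block `(Δ₀, c, sh, Sref)` per `t` carries the Schwinger-function limit, its gap and the joint
glue×IR-spectral limits — two independent `Sref` witnesses would leave stub 6 without a typed identification.) -/
def RefSeaControlled (reg : QCDRegularisation Nf) (m : Fin Nf → ℝ) (ℓq : ℝ) : Prop :=
  ∃ Δ₀ : ℝ, 0 < Δ₀ ∧
    ∀ A B : YMSpecies 𝔾, ∃ C : ℝ, ∀ᶠ k : ℕ in atTop, ∀ S : ℕ, reg.L k ≤ S → ∀ n : ℕ, n ≤ S →
      |refConnectedCorr reg m ℓq k S A.F B.F n| ≤ C * Real.exp (-(Δ₀ * (reg.a k * n)))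

/-- **M1 — tree mixing of the reference sea in the form a Kotecký–Preiss transfer consumes** (r12 = r9–r11 with the
size system DELETED, wave-4 audit A1; history: r2 two-functional ratio mixing, r5 margin guard, r8 ratio clause only at
physical margins — finding F1; r9/r10 weighted by a product size system `ε` — over-universal: saturating `ε` turns it into
exponent-one RATIO mixing for arbitrarily rare block events, caricature-false by the landed finite model
`Negative/WeightedClusterRatio.lean` (p109577) and unnecessary).  UNWEIGHTED strong cluster property of ALL orders for
`K'`-separated families of bounded BLOCK-local functionals of `μ_ref`, block = mesoscopic box of side `b = ⌈ℓ/(t a_k)⌉`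
(physical `ℓ_q = ℓ/t`), decay in PHYSICAL units across any `d`-margin split, prefactor `C₀^{Σ|Y_i|}`, constants
`Δ₀, C₀, K'` chosen BEFORE `t` (finding F6) — the Duneau–Iagolnitzer–Souillard form of complete analyticity at block
scale.  Stub 6 recovers the weights `(∏ε_i)^θ` (any `θ < 1`) from it and the product bound of `EdgeQuarantinedCond` by
interpolation (landed `Negative.weighted_split_bound_of_unweighted`, p109577) — multiplicative, hence still a
Kotecký–Preiss small parameter, at rate `(1−θ)Δ₀`.  KNOWN: a Bałaban FORMAT at scale `ℓ_q` plus Dobrushin–Shlosman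
mixing at block scale would imply it (Olivieri–Picco 1990); stub 6 consumes only this. -/
def RefSeaTreeMixing (reg : QCDRegularisation Nf) (m : Fin Nf → ℝ) (ℓ : ℝ) : Prop :=
  ∃ Δ₀ : ℝ, 0 < Δ₀ ∧ ∃ C₀ : ℝ, ∃ K' : ℕ, 0 < K' ∧ ∀ t : ℝ, 0 < t → t ≤ 1 →
    ∀ᶠ k : ℕ in atTop, ∀ S : ℕ, reg.L k ≤ S →
      ∀ (n : ℕ) (Y : Fin n → Finset (TorusSite 4 (2 * S + 1)))
        (X : Fin n → GaugeConfig 4 (2 * S + 1) 𝔾 → ℝ) (I : Finset (Fin n)) (d : ℕ),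
        let b : ℕ := ⌈ℓ / (t * reg.a k)⌉₊
        -- no wrap of the conditioning boxes and of the `d`-enlargements
        (2 * K' + 1) * b ≤ 2 * S + 1 → b + 2 * d ≤ 2 * S + 1 →
        -- `K'`-separated family: every block of `Y j` misses the `K'`-fold enlargement of every block of `Y i`
        (∀ i j, i ≠ j → ∀ c ∈ Y i, ∀ c' ∈ Y j, ∀ z, siteBox c' (fun _ => b) z →
            ¬ siteBox (fun a => c a - ((K' * b : ℕ) : ZMod (2 * S + 1))) (fun _ => (2 * K' + 1) * b) z) →
        (∀ i, Measurable (X i)) → (∀ i U, |X i U| ≤ 1) →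
        (∀ i, DependsOn (X i) {e : Edge 4 (2 * S + 1) | ∃ c ∈ Y i, siteBox c (fun _ => b) e.1}) →
        -- the split `I ∣ Iᶜ` is `d`-separated (lattice units)
        (∀ i ∈ I, ∀ j ∉ I, ∀ c ∈ Y i, ∀ c' ∈ Y j, ∀ z, siteBox c' (fun _ => b) z →
            ¬ siteBox (fun a => c a - (d : ZMod (2 * S + 1))) (fun _ => b + 2 * d) z) →
        |refExpect reg m (ℓ / t) k S (fun U => ∏ i, X i U) -
            refExpect reg m (ℓ / t) k S (fun U => ∏ i ∈ I, X i U) *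
              refExpect reg m (ℓ / t) k S (fun U => ∏ i ∈ Iᶜ, X i U)| ≤
          C₀ ^ (∑ i, (Y i).card) * Real.exp (-(Δ₀ * (reg.a k * d)))

/-- **M3 — (R2) + joint full-sequence IR universality of the reference sea** (r12, wave-4 audit A2–A4; r9 typed
obligation (U) of Disproof §6 but its glue coupling was VACUOUS — `c ≡ 0` witnessed it — and its `physCorner` boxes
could never equal the consumer's mesoscopic boxes).  For every `t ∈ (0,1]` ONE witness block `(Δ₀, c, sh, Sref, hS)`:
(R2') the reference Schwinger functions at split length `ℓ/t` converge along the FULL sequence (off-diagonal tensors)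
to an OS family `Sref` with mass gap `Δ₀`, non-trivial and non-Gaussian curvature — so `c` is an honest
renormalisation; AND, with the SAME `(c, sh)`, reference expectations of
`Φ(IR linear spectral statistics Σ_j h(λ_j/τ_k)) × (off-diagonal smeared glue product)` converge along the full
sequence, for every finite family of LATTICE boxes chosen by the consumer step by step (integer corners `cor k i`,
sides `sd k i`) whose physical geometry `a_k·cor`, `a_k·sd` converges (the mesoscopic boxes `siteBox y (K⌈ℓ/(t a_k)⌉)`
of `BadBox`/`cleanPart` are instances), `τ_k(t) = t a_k/(ℓ Z_m(k))`, `h` continuous compactly supported, `Φ` bounded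
continuous.  What the `k → ∞` limit of the cluster functionals of stub 6 consumes.  Untyped residue (audit A3): local
SIGNED edge factors and quark-sector IR kernels are not in this statistics class (inside stub 6, §7). -/
def RefSeaIRUniversality (reg : QCDRegularisation Nf) (m : Fin Nf → ℝ) (ℓ : ℝ) : Prop :=
  let r₃ : LatticeRep 𝔾 := ⟨3, fundamentalRep (Fin 3), continuous_fundamentalRep _,
    fundamentalRep_injective _, fundamentalRep_mem_unitaryGroup⟩
  ∀ t : ℝ, 0 < t → t ≤ 1 →
    ∃ (Δ₀ : ℝ) (c sh : YMSpecies 𝔾 → ℕ → ℝ)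
      (Sref : LabelledSchwingerFamily (YMSpecies 𝔾) (EuclideanSpace ℝ (Fin 4))) (hS : OSAxiomsSchwinger Sref),
      0 < Δ₀ ∧ Sref.HasMassGap Δ₀ ∧
      (OSData.ofAxioms Sref hS).IsNontrivial r₃.curvature ∧ (OSData.ofAxioms Sref hS).IsNonGaussian r₃.curvature ∧
      (∀ n : ℕ, n ≠ 0 → ∀ (σ : Fin n → YMSpecies 𝔾) (f : Fin n → 𝓢(EuclideanSpace ℝ (Fin 4), ℝ))
          (F : 𝓢((Fin n → EuclideanSpace ℝ (Fin 4)), ℂ)),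
          IsTensorOf F (fun i => ofRealTest (f i)) → IsOffDiagonal F →
            Tendsto (fun k : ℕ => ((refSchwinger reg m (ℓ / t) c sh k n σ f : ℝ) : ℂ)) atTop (𝓝 (Sref n σ F))) ∧
      ∀ (r : ℕ) (cor : ℕ → Fin r → (Fin 4 → ℤ)) (sd : ℕ → Fin r → ℕ) (fl : Fin r → Fin Nf)
        (h : Fin r → ℝ → ℝ) (Φ : (Fin r → ℝ) → ℝ),
        (∀ i a, ∃ x : ℝ, Tendsto (fun k : ℕ => reg.a k * (cor k i a : ℝ)) atTop (𝓝 x)) →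
        (∀ i, ∃ x : ℝ, Tendsto (fun k : ℕ => reg.a k * (sd k i : ℝ)) atTop (𝓝 x)) →
        (∀ i, Continuous (h i)) → (∀ i, HasCompactSupport (h i)) → Continuous Φ → (∃ B, ∀ v, |Φ v| ≤ B) →
        ∀ (n : ℕ) (σ : Fin n → YMSpecies 𝔾) (f : Fin n → 𝓢(EuclideanSpace ℝ (Fin 4), ℝ))
          (F : 𝓢((Fin n → EuclideanSpace ℝ (Fin 4)), ℂ)),
          IsTensorOf F (fun i => ofRealTest (f i)) → IsOffDiagonal F →
          ∃ Lim : ℝ, Tendsto (fun k : ℕ =>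
            refExpect reg m (ℓ / t) k (reg.L k) (fun U =>
              Φ (fun i => ∑ j, h i
                (((Literature.Barriers.QuantumFields.WilsonDeterminant.isHermitian_hermitianWilsonDirac
                      (fundamentalRep (Fin 3)) fundamentalRep_mem_unitaryGroup U
                      (reg.mcrit k + reg.a k * m (fl i) / reg.Zm k) 1).submatrix
                    (Subtype.val :
                      {p : QIdx (2 * reg.L k + 1) //
                        siteBox (fun a => ((cor k i a : ℤ) : ZMod (2 * reg.L k + 1))) (fun _ => sd k i) p.1} →
                      QIdx (2 * reg.L k + 1))).eigenvalues j / (t * reg.a k / ℓ / reg.Zm k))) *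
              ∏ i, smearedLatticeField ((σ i).F) (Literature.Probability.LatticeModels.box 4 (reg.L k))
                (reg.a k) (c (σ i) k) (sh (σ i) k) (f i) (torusLift (2 * reg.L k + 1) U)))
            atTop (𝓝 Lim)


/-- **Registered sanity sub-goal**: the reference weight `w_ref = exp(Σ_f F_f)` is positive for every field
(so `μ_ref` has a positive density against Wilson's measure; positivity of its NORMALISATION needs in addition the
measurability of `F`, i.e. stub 8). -/
theorem refWeight_pos : ∀ {Nf : ℕ} (reg : QCDRegularisation Nf) (m : Fin Nf → ℝ) (ℓq : ℝ) (k : ℕ) {S : ℕ} (U : GaugeConfig 4 (2 * S + 1) (Matrix.specialUnitaryGroup (Fin 3) ℂ)), 0 < refWeight reg m ℓq k U :=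
  fun _ _ _ _ _ _ => Real.exp_pos _

end Reference

end Summit.QuantumFields.QCD.Cruxes.SeaFactorisationBridge.ProperTimeQuarantine

end
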